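import Summits.QuantumAdvantage.QuantumAdvantage.Theorems.WbwObfuscatedGluedTreesKowClearPresentationCircuits

/-!
# Stub `stub_presentation` (part II) — non-vacuity of `GenAdmissible`: a circuit presentation of the neighbour predicate and
# admissible schedules for every efficient obfuscator  (crux `WbwObfuscatedGluedTrees`, stmt-QuantumAdvantage-2340;
# line `knowledge-of-walk-split`, stage 3, lead prover-line-stmt-QuantumAdvantage-2340-c2-0)

Given an efficient obfuscator `O`, a scheme `P` whose neighbour predicate is polynomial-time ON CODES (`NbrBitFP P`,
inlined), and the three generic lemmas of the stage-3 skeleton as hypotheses (schedules, hard-wiring, code length),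
we EXHIBIT a master datum `D` with `GenAdmissible D O P`, `RefAdmissible D D.Γ O` and depth `→ ∞`:

* the language `{z | f z = [true]}` of the `FP` witness `f` of `NbrBitFP` is in `P` (`mem_P_of_mem_FP`), hence decided
  by a polynomial-size family of `B₂`-circuits (`P_subset_PPoly_holds`);
* at level `ℓ` (PRF parameter `ℓ`, depth `ℓ + 1`, names of `N = 3ℓ + 5` bits) the code of the tuple
  `(1^ℓ, 1^{ℓ+1}, k₀, k₁, k₂, k₃, x)` is `prefix ++ x` with the prefix depending on the keys only; hard-wire the prefix
  into the circuit of that input length (hypothesis F): the result computes `N_K` on the `2N` query wires, its size is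
  bounded by a polynomial `ς ℓ` in `ℓ`, and its CODE LENGTH depends on `ℓ` and the key lengths only — so the obfuscator's
  coin demand at level `ℓ` is ONE number `c n = O.coinLen (…)` for all keys of full length;
* the key-part schedule `t` comes from hypothesis E with `p := ς` and `R :=` (coin-budget polynomial of `O`) ∘ (input
  length polynomial), giving clauses (1)–(4) and (8) of `GenAdmissible`; (5)–(7) are the bounds above.

No hardness content; no new axiom. [folklore]
-/

set_option linter.dupNamespace false

noncomputable section

namespace Summit.QuantumAdvantage.QuantumAdvantage.Theorems.WbwObfuscatedGluedTrees.KnowledgeOfWalk.Generator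

open Literature.Computability.Cryptography Literature.Computability.Complexity Filter Asymptotics
open Literature.Computability.Cryptography.ObfuscatedGluedTrees
open Literature.Computability.QuantumComplexity
open Literature.Computability.Complexity.CodeFP (natE unE bitE pairE strE)
open _root_.Computability (unaryEncodeNat encodeNat)

namespace Presentation

/-! ## The remaining hypotheses of the stub, named -/

/-- Statement of `stub_schedules` (verbatim; a hypothesis — the landed `stub_schedules` proves it; not a cited fact). -/
def SchedHyp : Prop :=
  ∀ (p R : Polynomial ℕ), (∀ ℓ, ℓ ≤ p.eval ℓ) →
    ∃ t : ℕ → ℕ,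
      PolyTimeComputable Computability.unaryEncodeNat Computability.unaryEncodeNat t ∧
      PolyTimeComputable Computability.unaryEncodeNat Computability.unaryEncodeNat (fun n => p.eval (t n)) ∧
      (∃ c : ℝ, 0 < c ∧ ∀ᶠ n : ℕ in atTop, (n : ℝ) ^ c ≤ ((p.eval (t n) : ℕ) : ℝ)) ∧
      (∃ p' : Polynomial ℕ, ∀ n, p.eval (t n) ≤ p'.eval n) ∧
      (∀ n, 4 * t n ≤ n) ∧
      (∃ n₀ : ℕ, ∀ n, n₀ ≤ n → R.eval (t n) + 4 * t n ≤ n) ∧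
      (∀ B : ℕ, ∃ n₀ : ℕ, ∀ n, n₀ ≤ n → B ≤ t n)

/-- Statement of `stub_codeLength` (verbatim; a hypothesis — the landed `stub_codeLength` proves it; not a cited
fact). -/
def CodeLenHyp : Prop :=
  ∃ c : ℕ, ∀ (n : ℕ) (C : Literature.Computability.Complexity.Circuit (Fin n)), C.IsOver B2 →
    (encodeCircuit C).length ≤ c * (n + C.size + 1) ^ 2

section Circ

variable {P : PuncturablePRFScheme}

/-! ## Sizes and code lengths -/

/-- The obfuscator-parameter polynomial `ς`: size of the `P/poly` circuit at the largest input length, plus that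
length, plus the arity, plus `ℓ`. [folklore] -/
def sPoly (hN : NbrHyp P) : Polynomial ℕ :=
  (sizePoly hN).comp (Polynomial.C 18 * Polynomial.X + Polynomial.C 24) +
    (Polynomial.C 18 * Polynomial.X + Polynomial.C 24) + (Polynomial.C 6 * Polynomial.X + Polynomial.C 10) + Polynomial.X

/-- Evaluation of `sPoly`. [folklore] -/
theorem sPoly_eval (hN : NbrHyp P) (ℓ : ℕ) :
    (sPoly hN).eval ℓ = (sizePoly hN).eval (18 * ℓ + 24) + (18 * ℓ + 24) + (6 * ℓ + 10) + ℓ := by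
  simp [sPoly, Polynomial.eval_comp]

/-- `ℓ ≤ ς ℓ`. [folklore] -/
theorem le_sPoly_eval (hN : NbrHyp P) (ℓ : ℕ) : ℓ ≤ (sPoly hN).eval ℓ := by
  rw [sPoly_eval]; omega

/-- Size bound: `2N + |circ| ≤ ς ℓ`. [folklore] -/
theorem ar_add_size_le (hN : NbrHyp P) (hF : HardwireHyp) (ℓ : ℕ) (K : List Bool) :
    ar ℓ + (circ hN hF ℓ K).size ≤ (sPoly hN).eval ℓ := by
  have hs := (hw_spec hN hF ℓ (prefK ℓ K).length).2.1 (fun j => (prefK ℓ K).getD j false)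
  have hL := length_prefK_le ℓ K
  have hM : (prefK ℓ K).length + ar ℓ ≤ 18 * ℓ + 24 := by rw [ar_eq]; omega
  have hsize : (cfam hN ((prefK ℓ K).length + ar ℓ)).size ≤ (sizePoly hN).eval (18 * ℓ + 24) :=
    (((cfam_spec hN).1 _).2).trans (natPoly_eval_mono _ hM)
  have har := ar_eq ℓ
  rw [sPoly_eval]
  change ar ℓ + (hw hN hF ℓ (prefK ℓ K).length fun j => (prefK ℓ K).getD j false).size ≤ _
  omega

/-- Membership in `ppolyCircuits (ς ℓ)`. [folklore] -/
theorem circ_mem_ppoly (hN : NbrHyp P) (hF : HardwireHyp) (ℓ : ℕ) (K : List Bool) :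
    (⟨ar ℓ, circ hN hF ℓ K⟩ : SizedCircuit) ∈ ppolyCircuits ((sPoly hN).eval ℓ) :=
  (mem_ppolyCircuits_iff _ _ _).2 ⟨circ_isOver hN hF ℓ K, ar_add_size_le hN hF ℓ K⟩

/-- The code-length polynomial `q`: `2·2N + 2 + c (ς + 1)²`. [folklore] -/
def qPoly (hN : NbrHyp P) (c : ℕ) : Polynomial ℕ :=
  Polynomial.C 2 * (Polynomial.C 6 * Polynomial.X + Polynomial.C 10) + Polynomial.C 2 +
    Polynomial.C c * (sPoly hN + 1) ^ 2

/-- Evaluation of `qPoly`. [folklore] -/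
theorem qPoly_eval (hN : NbrHyp P) (c ℓ : ℕ) :
    (qPoly hN c).eval ℓ = 2 * (6 * ℓ + 10) + 2 + c * ((sPoly hN).eval ℓ + 1) ^ 2 := by
  simp [qPoly]

/-- Code length of the circuit alone: `≤ c (ς ℓ + 1)²` for the constant of hypothesis F′. [folklore] -/
theorem length_encodeCircuit_circ_le (hN : NbrHyp P) (hF : HardwireHyp) {c : ℕ}
    (hc : ∀ (n : ℕ) (C : Literature.Computability.Complexity.Circuit (Fin n)), C.IsOver B2 →
      (encodeCircuit C).length ≤ c * (n + C.size + 1) ^ 2) (ℓ : ℕ) (K : List Bool) :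
    (encodeCircuit (circ hN hF ℓ K)).length ≤ c * ((sPoly hN).eval ℓ + 1) ^ 2 :=
  (hc _ _ (circ_isOver hN hF ℓ K)).trans
    (Nat.mul_le_mul_left c (Nat.pow_le_pow_left (Nat.succ_le_succ (ar_add_size_le hN hF ℓ K)) 2))

/-- Code length of the sized circuit: `≤ q ℓ`. [folklore] -/
theorem length_encodeSized_circ_le (hN : NbrHyp P) (hF : HardwireHyp) {c : ℕ}
    (hc : ∀ (n : ℕ) (C : Literature.Computability.Complexity.Circuit (Fin n)), C.IsOver B2 →
      (encodeCircuit C).length ≤ c * (n + C.size + 1) ^ 2) (ℓ : ℕ) (K : List Bool) :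
    (encodeSizedCircuit ⟨ar ℓ, circ hN hF ℓ K⟩).length ≤ (qPoly hN c).eval ℓ := by
  rw [qPoly_eval, encodeSizedCircuit, length_boolPair, ← ar_eq ℓ]
  have h1 : (encodeNat (ar ℓ)).length ≤ ar ℓ := by
    rw [show encodeNat (ar ℓ) = natE (ar ℓ) from rfl, CodeFP.length_natE]
    exact Nat.size_le.2 Nat.lt_two_pow_self
  have h2 := length_encodeCircuit_circ_le hN hF hc ℓ K
  change 2 * (encodeNat (ar ℓ)).length + 2 + (encodeCircuit (circ hN hF ℓ K)).length ≤ _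
  omega

/-- The obfuscator's input length at level `ℓ` for key material of full length: ONE number. [folklore] -/
def gLen (hN : NbrHyp P) (hF : HardwireHyp) (ℓ : ℕ) : ℕ :=
  2 * (sPoly hN).eval ℓ + 2 + (2 * (encodeNat (ar ℓ)).length + 2 + codeLen₀ hN hF ℓ)

/-- The obfuscator's input length is `gLen ℓ` for key material of full length. [folklore] -/
theorem length_encodeInput_circ (hN : NbrHyp P) (hF : HardwireHyp) (ℓ : ℕ) {K : List Bool} (hK : K.length = 4 * ℓ) :
    (CircuitObfuscator.encodeInput ((sPoly hN).eval ℓ, ⟨ar ℓ, circ hN hF ℓ K⟩)).length = gLen hN hF ℓ := by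
  rw [CircuitObfuscator.encodeInput, length_boolPair, CodeFP.length_unE, gLen, encodeSizedCircuit, length_boolPair,
    ← length_encode_circ hN hF ℓ hK]

/-- The input-length polynomial `G`: `2ς + 2 + q`. [folklore] -/
def gPoly (hN : NbrHyp P) (c : ℕ) : Polynomial ℕ := Polynomial.C 2 * sPoly hN + Polynomial.C 2 + qPoly hN c

/-- `gLen ℓ ≤ G ℓ`. [folklore] -/
theorem gLen_le (hN : NbrHyp P) (hF : HardwireHyp) {c : ℕ}
    (hc : ∀ (n : ℕ) (C : Literature.Computability.Complexity.Circuit (Fin n)), C.IsOver B2 →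
      (encodeCircuit C).length ≤ c * (n + C.size + 1) ^ 2) (ℓ : ℕ) :
    gLen hN hF ℓ ≤ (gPoly hN c).eval ℓ := by
  have hK : (List.replicate (4 * ℓ) false).length = 4 * ℓ := List.length_replicate
  have h := length_encodeSized_circ_le hN hF hc ℓ (List.replicate (4 * ℓ) false)
  rw [encodeSizedCircuit, length_boolPair, length_encode_circ hN hF ℓ hK] at h
  simp only [gPoly, Polynomial.eval_add, Polynomial.eval_mul, Polynomial.eval_C, gLen]
  change 2 * (sPoly hN).eval ℓ + 2 + (2 * (encodeNat (ar ℓ)).length + 2 + codeLen₀ hN hF ℓ) ≤ _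
  have : 2 * (encodeNat (ar ℓ)).length + 2 + codeLen₀ hN hF ℓ ≤ (qPoly hN c).eval ℓ := h
  omega

end Circ

/-! ## The master datum and the registered stub -/

section Main

variable {O : CircuitObfuscator} {P : PuncturablePRFScheme}

/-- **The master datum** for `(O, P)`: key-part schedule `t`, depth `ℓ + 1`, PRF parameter `ℓ`, obfuscator parameter
`ς ℓ`, coin schedule `O.coinLen (gLen (t n))`, presentation `circ`. [folklore] -/
def datum (O : CircuitObfuscator) (hN : NbrHyp P) (hF : HardwireHyp) (t : ℕ → ℕ) : MasterData where
  t := t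
  δ ℓ := ℓ + 1
  δ_pos ℓ := Nat.succ_pos ℓ
  π ℓ := ℓ
  ς ℓ := (sPoly hN).eval ℓ
  c n := O.coinLen (gLen hN hF (t n))
  Γ ℓ K := circ hN hF ℓ K

/-- The coin demand of `O` on the presentation at level `ℓ`, for key material of full length. [folklore] -/
theorem coins_eq (hN : NbrHyp P) (hF : HardwireHyp) (ℓ : ℕ) {K : List Bool} (hK : K.length = 4 * ℓ) :
    O.coins ((sPoly hN).eval ℓ) (circ hN hF ℓ K) = O.coinLen (gLen hN hF ℓ) := by
  rw [CircuitObfuscator.coins, length_encodeInput_circ hN hF ℓ hK]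

/-- **Main lemma**: the datum built from the schedule of hypothesis E is admissible, with depth `→ ∞`. [folklore] -/
theorem main (hO : O.IsEfficient) (hN : NbrHyp P) (hE : SchedHyp) (hF : HardwireHyp) (hF' : CodeLenHyp) :
    ∃ D : MasterData, GenAdmissible D O P ∧ RefAdmissible D D.Γ O ∧
      ∀ B : ℕ, ∃ n₀ : ℕ, ∀ n, n₀ ≤ n → B ≤ D.δ (D.t n) := by
  obtain ⟨c, hc⟩ := hF'
  obtain ⟨Bc, hBc⟩ := hO.2
  -- the resource polynomial: coin budget ∘ input length
  set R : Polynomial ℕ := Bc.comp (gPoly hN c) with hR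
  obtain ⟨t, _ht1, ht2, ht3, ht4, ht5, ht6, ht7⟩ := hE (sPoly hN) R (le_sPoly_eval hN)
  have hcoins : ∀ ℓ (K : List Bool), K.length = 4 * ℓ →
      O.coins ((sPoly hN).eval ℓ) (circ hN hF ℓ K) ≤ R.eval ℓ := by
    intro ℓ K hK
    rw [coins_eq hN hF ℓ hK, hR, Polynomial.eval_comp]
    refine (?_ : O.coinLen (gLen hN hF ℓ) ≤ Bc.eval (gLen hN hF ℓ)).trans (natPoly_eval_mono Bc (gLen_le hN hF hc ℓ))
    have := hBc (gLen hN hF ℓ)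
    simpa using this
  obtain ⟨n₀, hn₀⟩ := ht6
  refine ⟨datum O hN hF t, ⟨ht2, ht3, ht4, ht5, ?_, ?_, ?_, ?_⟩, ⟨?_, ?_, ?_⟩, ?_⟩
  · -- (5) code length of the shipped presentation
    refine ⟨qPoly hN c, fun ℓ K => ?_⟩
    exact (length_encodeSized_circ_le hN hF hc ℓ K).trans (natPoly_eval_mono _ (Nat.le_add_right ℓ K.length))
  · -- (6) membership in `ppolyCircuits (ς ℓ)`
    exact fun ℓ K => circ_mem_ppoly hN hF ℓ K
  · -- (7) the presentation computes `N_K`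
    exact fun ℓ K x => circ_eval hN hF ℓ K x
  · -- (8) the coin discipline
    refine ⟨n₀, fun n hn K hK => ⟨?_, ?_⟩⟩
    · have h1 := hcoins (t n) K hK
      have h2 := hn₀ n hn
      change O.coins ((sPoly hN).eval (t n)) (circ hN hF (t n) K) + 4 * t n ≤ n
      omega
    · change O.coinLen (gLen hN hF (t n)) = O.coins ((sPoly hN).eval (t n)) (circ hN hF (t n) K)
      rw [coins_eq hN hF (t n) hK]
  · -- reference: code length
    refine ⟨qPoly hN c, fun ℓ K => ?_⟩
    exact (length_encodeSized_circ_le hN hF hc ℓ K).trans (natPoly_eval_mono _ (Nat.le_add_right ℓ K.length))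
  · -- reference: membership, equal size, equal function
    exact fun ℓ K => ⟨circ_mem_ppoly hN hF ℓ K, rfl, fun _ => rfl⟩
  · -- reference: coin discipline
    refine ⟨n₀, fun n hn K hK => ?_⟩
    have h1 := hcoins (t n) K hK
    have h2 := hn₀ n hn
    change O.coins ((sPoly hN).eval (t n)) (circ hN hF (t n) K) + 4 * t n ≤ n
    omega
  · -- depth → ∞
    intro B
    obtain ⟨n₁, hn₁⟩ := ht7 B
    exact ⟨n₁, fun n hn => (hn₁ n hn).trans (Nat.le_succ _)⟩

end Main

end Presentation

/-- **Registered stage-3 stub `stub_presentation` — non-vacuity of `GenAdmissible`.**  For an efficient obfuscator and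
a scheme whose neighbour predicate is polynomial-time on codes, given the schedule, hard-wiring and code-length lemmas
(stubs E, F, F′ as hypotheses), SOME master datum is `GenAdmissible` (and `RefAdmissible` for its own presentation)
with depth `→ ∞` along the key schedule (`Presentation.main` on `Presentation.datum`). [folklore] -/
theorem stub_presentation :
    ∀ (O : CircuitObfuscator) (P : PuncturablePRFScheme), O.IsEfficient →
      (Literature.Computability.Complexity.CodeFP
        (pairE unE (pairE unE (pairE strE (pairE strE (pairE strE (pairE strE strE))))))
        bitE
        (fun t : ℕ × ℕ × List Bool × List Bool × List Bool × List Bool × List Bool =>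
          if 1 ≤ t.2.1 then
            nbrBit (cycleOf P t.1 t.2.2.2.2.1 t.2.2.2.2.2.1 t.2.1) (naming P t.1 t.2.2.1 t.2.2.2.1 t.2.1)
              (fun i => t.2.2.2.2.2.2.getD (i : ℕ) false)
          else false)) →
      (∀ (p R : Polynomial ℕ), (∀ ℓ, ℓ ≤ p.eval ℓ) →
        ∃ t : ℕ → ℕ,
          PolyTimeComputable Computability.unaryEncodeNat Computability.unaryEncodeNat t ∧
          PolyTimeComputable Computability.unaryEncodeNat Computability.unaryEncodeNat (fun n => p.eval (t n)) ∧
          (∃ c : ℝ, 0 < c ∧ ∀ᶠ n : ℕ in atTop, (n : ℝ) ^ c ≤ ((p.eval (t n) : ℕ) : ℝ)) ∧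
          (∃ p' : Polynomial ℕ, ∀ n, p.eval (t n) ≤ p'.eval n) ∧
          (∀ n, 4 * t n ≤ n) ∧
          (∃ n₀ : ℕ, ∀ n, n₀ ≤ n → R.eval (t n) + 4 * t n ≤ n) ∧
          (∀ B : ℕ, ∃ n₀ : ℕ, ∀ n, n₀ ≤ n → B ≤ t n)) →
      (∀ (M m : ℕ) (ρ : Fin M → Option (Fin m)) (C : Literature.Computability.Complexity.Circuit (Fin M)), C.IsOver B2 →
        ∃ H : (Fin M → Bool) → Literature.Computability.Complexity.Circuit (Fin m),
          (∀ v, (H v).IsOver B2) ∧ (∀ v, (H v).size ≤ C.size + M) ∧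
          (∀ v x, (H v).eval x = C.eval (fun i => (ρ i).elim (v i) x)) ∧
          (∀ v v', (encodeCircuit (H v)).length = (encodeCircuit (H v')).length)) →
      (∃ c : ℕ, ∀ (n : ℕ) (C : Literature.Computability.Complexity.Circuit (Fin n)), C.IsOver B2 →
        (encodeCircuit C).length ≤ c * (n + C.size + 1) ^ 2) →
      ∃ D : MasterData, GenAdmissible D O P ∧ RefAdmissible D D.Γ O ∧
        ∀ B : ℕ, ∃ n₀ : ℕ, ∀ n, n₀ ≤ n → B ≤ D.δ (D.t n) :=
  fun _ _ hO hN hE hF hF' => Presentation.main hO hN hE hF hF'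

end Summit.QuantumAdvantage.QuantumAdvantage.Theorems.WbwObfuscatedGluedTrees.KnowledgeOfWalk.Generator

end
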